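import Literature.Geometry.Riemannian.L2HarmonicOneFormsSobolev
import Literature.Geometry.Riemannian.RiemannianDistance
import Literature.Geometry.Lorentzian.EnergyCurrents
import Literature.Geometry.Lorentzian.GreenIdentity
import Literature.Geometry.Lorentzian.VolumeProofs
import HarnessLib

/-!
# Dirichlet energy of `χ - v`, `v ∈ C_c^∞`: parallelogram law, first variation, and the
# `L^{2p/(p-2)}` control given by a Sobolev inequality (Carron 2007, Prop. 2.11 / Remark 2.6)

Fifth layer (analysis, part A: pointwise and integrated energy estimates, no PDE) of the proof
programme of `Literature.Geometry.Riemannian.Carron1998_ends_le_rank_l2HarmonicOneForms`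
(`L2HarmonicOneFormsSobolev.lean`). In G. Carron, *L² harmonic forms on non-compact Riemannian
manifolds*, arXiv:0704.3194 (2007), the harmonic function attached to an end is obtained either
through the Hodge decomposition (Prop. 2.5: "`du = α = η + dv`") or variationally (Remark 2.6:
"`u_k` is the minimizer of the functional `u ↦ ∫ |du|²`"); and the Sobolev inequality enters
through "`‖df_k - df_l‖_{L²} ≥ …`, we conclude that this sequence `(f_k)` converges to some
`f ∈ L^{2ν/(ν-2)}`" (proofs of Prop. 2.4 and Prop. 2.11). This file PROVES the elementary
estimates of the variational route for the Dirichlet energy `E(v) = ∫_X |d(χ - v)|²_h dV_h`,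
`v ∈ C_c^∞(X)`, of a smooth `χ` whose differential has compact support (the cutoff of an end),
on a Riemannian manifold `(X, h)` (any real model with corners, `h` a smooth Mathlib metric; the
gradient square `|dw|²_h = (ofRiemannian h).gradSq w`, the Riemannian measure `riemannianMeasure h`):

* `gradSq_add_add_gradSq_sub` — the pointwise parallelogram law
  `|d(f+g)|² + |d(f-g)|² = 2|df|² + 2|dg|²`; `abs_innerDual_le` — Cauchy–Schwarz for `h⁻¹`;
* `integrable_gradSq_sub` — `|d(χ - v)|²_h` is continuous with compact support, hence integrable;
* `integral_gradSq_sub_sub_parallelogram` — **the parallelogram identity for energies**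
  `∫ |d(v₁ - v₂)|² = 2 E(v₁) + 2 E(v₂) - 4 E((v₁ + v₂)/2)` (so a minimising sequence has
  `∫ |d(vₙ - v_k)|² → 0`);
* `integral_gradSq_sub_add_smul` and `sq_integral_innerDual_le_of_forall_le` — **first variation
  at an almost-minimiser**: `E(v + tζ) = E(v) - 2t ∫ h⁻¹(d(χ-v), dζ) + t² ∫ |dζ|²`, whence
  `(∫ h⁻¹(d(χ - v), dζ))² ≤ (E(v) - m) ∫ |dζ|²` whenever `m ≤ E(w)` for all `w ∈ C_c^∞`;
* `ofReal_mul_eLpNorm_sq_le_lintegral_gradSq` — **the Sobolev inequality in `L^q` form**: under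
  `HasSobolevInequality h p μ` (`p > 2`), `μ ‖w‖²_{L^q} ≤ ∫ |dw|²_h` for `w ∈ C_c^∞(X)`,
  `q = 2p/(p-2)`.

Everything is proved; no definitions, no named facts (D-0026).

## References

* G. Carron, *L² harmonic forms on non-compact Riemannian manifolds*, arXiv:0704.3194 (2007),
  Prop. 2.4, Prop. 2.5, Remark 2.6, Prop. 2.11. [`Carron2007`]
-/

noncomputable section

open Bundle Set Function Filter Topology MeasureTheory
open scoped Manifold ContDiff ENNReal NNReal

namespace Literature.Geometry.Riemannian

open Literature.Geometry.Lorentzian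
open Literature.Geometry.Lorentzian.PseudoRiemannianMetric

/-! ### Pointwise algebra of the gradient square -/

section Pointwise

variable {E : Type*} [NormedAddCommGroup E] [NormedSpace ℝ E] [FiniteDimensional ℝ E]
  {H : Type*} [TopologicalSpace H] {I : ModelWithCorners ℝ E H} {n : ℕ∞ω}
  {X : Type*} [TopologicalSpace X] [ChartedSpace H X] [IsManifold I ∞ X]
  (g : PseudoRiemannianMetric I n E (TangentSpace I : X → Type _))

/-- **Parallelogram law for the gradient square**: at a point where `f` and `g'` are
differentiable, `|d(f + g')|²_g + |d(f - g')|²_g = 2 |df|²_g + 2 |dg'|²_g` (bilinearity of `g⁻¹`).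
[folklore] -/
theorem gradSq_add_add_gradSq_sub {f g' : X → ℝ} {x : X} (hf : MDiffAt f x) (hg : MDiffAt g' x) :
    g.gradSq (f + g') x + g.gradSq (f - g') x = 2 * g.gradSq f x + 2 * g.gradSq g' x := by
  simp only [PseudoRiemannianMetric.gradSq, PseudoRiemannianMetric.innerDual, mvfderiv_add hf hg,
    mvfderiv_sub hf hg, ContinuousLinearMap.toLinearMap_add, ContinuousLinearMap.toLinearMap_sub,
    map_add, map_sub, LinearMap.add_apply, LinearMap.sub_apply]
  have hs : (mvfderiv I g' x : TangentSpace I x →ₗ[ℝ] ℝ) (g.sharp x (mvfderiv I f x : TangentSpace I x →ₗ[ℝ] ℝ)) =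
      (mvfderiv I f x : TangentSpace I x →ₗ[ℝ] ℝ) (g.sharp x (mvfderiv I g' x : TangentSpace I x →ₗ[ℝ] ℝ)) :=
    g.innerDual_comm x _ _
  simp only [ContinuousLinearMap.coe_coe] at hs ⊢
  linarith [hs]

/-- `|d(c w)|²_g = c² |dw|²_g` at a point where `w` is differentiable. [folklore] -/
theorem gradSq_const_mul {w : X → ℝ} {x : X} (hw : MDiffAt w x) (c : ℝ) :
    g.gradSq (fun y ↦ c * w y) x = c ^ 2 * g.gradSq w x := by
  have h1 : mvfderiv I (fun y ↦ c * w y) x = c • mvfderiv I w x := by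
    rw [mvfderiv_fun_mul mdifferentiableAt_const hw, mvfderiv_const]; simp
  simp only [PseudoRiemannianMetric.gradSq, PseudoRiemannianMetric.innerDual, h1,
    ContinuousLinearMap.toLinearMap_smul, map_smul, LinearMap.smul_apply, smul_eq_mul]
  ring

/-- **Cauchy–Schwarz for the inverse metric** of a Riemannian `g`:
`|g⁻¹(α, β)| ≤ √(g⁻¹(α, α)) √(g⁻¹(β, β))` (`g⁻¹(α, β) = g(♯α, ♯β)` is an inner product).
[folklore] -/
theorem abs_innerDual_le (hg : g.IsRiemannian) (x : X) (α β : Module.Dual ℝ (TangentSpace I x)) :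
    |g.innerDual x α β| ≤ Real.sqrt (g.innerDual x α α) * Real.sqrt (g.innerDual x β β) := by
  letI := g.riemannianBundle hg
  rw [PseudoRiemannianMetric.innerDual_eq_val_sharp_sharp,
    PseudoRiemannianMetric.innerDual_eq_val_sharp_sharp,
    PseudoRiemannianMetric.innerDual_eq_val_sharp_sharp, ← g.inner_eq hg, ← g.inner_eq hg,
    ← g.inner_eq hg, real_inner_self_eq_norm_sq, real_inner_self_eq_norm_sq,
    Real.sqrt_sq (norm_nonneg _), Real.sqrt_sq (norm_nonneg _)]
  exact abs_real_inner_le_norm _ _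

end Pointwise

/-! ### Integrated energies -/

section Energy

variable {E : Type*} [NormedAddCommGroup E] [NormedSpace ℝ E] [FiniteDimensional ℝ E]
  {H : Type*} [TopologicalSpace H] {I : ModelWithCorners ℝ E H} [I.Boundaryless]
  {X : Type*} [TopologicalSpace X] [ChartedSpace H X] [IsManifold I ∞ X]
  [T3Space X] [MeasurableSpace X] [BorelSpace X]
  (h : ContMDiffRiemannianMetric I ∞ E (TangentSpace I : X → Type _))

/-- The energy density `|d(χ - v)|²_h` of `χ ∈ C^∞` with `dχ = 0` off a compact set `K₁` and
`v ∈ C_c^∞` is continuous with compact support (inside `K₁ ∪ tsupport v`), hence integrable for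
the Riemannian measure. [folklore] -/
theorem integrable_gradSq_sub {χ v : X → ℝ} (hχ : ContMDiff I 𝓘(ℝ, ℝ) ∞ χ) {K₁ : Set X}
    (hK₁ : IsCompact K₁) (hχK : ∀ x ∉ K₁, mvfderiv I χ x = 0) (hv : ContMDiff I 𝓘(ℝ, ℝ) ∞ v)
    (hvc : HasCompactSupport v) :
    Continuous ((PseudoRiemannianMetric.ofRiemannian h).gradSq (χ - v)) ∧
    HasCompactSupport ((PseudoRiemannianMetric.ofRiemannian h).gradSq (χ - v)) ∧
    Integrable ((PseudoRiemannianMetric.ofRiemannian h).gradSq (χ - v)) (riemannianMeasure h) := by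
  haveI : IsFiniteMeasureOnCompacts (riemannianMeasure h) :=
    ⟨fun K hK ↦ riemannianVolume_lt_top_of_isCompact_holds h le_rfl hK⟩
  have hw : ContMDiff I 𝓘(ℝ, ℝ) 1 (χ - v) := (hχ.sub hv).of_le (by norm_num)
  have hc : Continuous ((PseudoRiemannianMetric.ofRiemannian h).gradSq (χ - v)) :=
    continuous_innerDual_mvfderiv _ hw hw
  have hsupp : support ((PseudoRiemannianMetric.ofRiemannian h).gradSq (χ - v)) ⊆ K₁ ∪ tsupport v := by
    intro x hx
    by_contra hx'
    simp only [mem_union, not_or] at hx'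
    apply hx
    have hd : mvfderiv I (χ - v) x = 0 := by
      rw [mvfderiv_sub ((hχ x).mdifferentiableAt (by simp)) ((hv x).mdifferentiableAt (by simp)),
        hχK x hx'.1, mvfderiv_eq_zero_of_notMem_tsupport hx'.2, sub_zero]
    simp [PseudoRiemannianMetric.gradSq, PseudoRiemannianMetric.innerDual, hd]
  have hcs : HasCompactSupport ((PseudoRiemannianMetric.ofRiemannian h).gradSq (χ - v)) :=
    HasCompactSupport.of_support_subset_isCompact (hK₁.union hvc.isCompact) hsupp
  exact ⟨hc, hcs, hc.integrable_of_hasCompactSupport hcs⟩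

/-- **Parallelogram identity for Dirichlet energies** (the convexity behind Carron's minimising
sequences, Remark 2.6: "`u_k` is the minimizer of the functional `u ↦ ∫ |du|²`"): for `χ` smooth
with compactly supported differential and `v₁, v₂ ∈ C_c^∞`,
`∫ |d(v₁ - v₂)|² = 2 ∫ |d(χ - v₁)|² + 2 ∫ |d(χ - v₂)|² - 4 ∫ |d(χ - (v₁ + v₂)/2)|²`.
[cite: Carron2007, Remark 2.6] -/
theorem integral_gradSq_sub_sub_parallelogram {χ v₁ v₂ : X → ℝ} (hχ : ContMDiff I 𝓘(ℝ, ℝ) ∞ χ)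
    {K₁ : Set X} (hK₁ : IsCompact K₁) (hχK : ∀ x ∉ K₁, mvfderiv I χ x = 0)
    (hv₁ : ContMDiff I 𝓘(ℝ, ℝ) ∞ v₁) (hv₁c : HasCompactSupport v₁)
    (hv₂ : ContMDiff I 𝓘(ℝ, ℝ) ∞ v₂) (hv₂c : HasCompactSupport v₂) :
    ∫ x, (PseudoRiemannianMetric.ofRiemannian h).gradSq (v₁ - v₂) x ∂riemannianMeasure h =
      2 * ∫ x, (PseudoRiemannianMetric.ofRiemannian h).gradSq (χ - v₁) x ∂riemannianMeasure h +
      2 * ∫ x, (PseudoRiemannianMetric.ofRiemannian h).gradSq (χ - v₂) x ∂riemannianMeasure h -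
      4 * ∫ x, (PseudoRiemannianMetric.ofRiemannian h).gradSq
        (χ - fun y ↦ (1 / 2 : ℝ) * (v₁ y + v₂ y)) x ∂riemannianMeasure h := by
  set g := PseudoRiemannianMetric.ofRiemannian h with hgdef
  -- the midpoint and half-difference are compactly supported smooth functions
  have hmid : ContMDiff I 𝓘(ℝ, ℝ) ∞ (fun y ↦ (1 / 2 : ℝ) * (v₁ y + v₂ y)) :=
    contMDiff_const.mul (hv₁.add hv₂)
  have hmidc : HasCompactSupport (fun y ↦ (1 / 2 : ℝ) * (v₁ y + v₂ y)) :=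
    (hv₁c.add hv₂c).mul_left
  have hdif : ContMDiff I 𝓘(ℝ, ℝ) ∞ (fun y ↦ (1 / 2 : ℝ) * (v₂ y - v₁ y)) :=
    contMDiff_const.mul (hv₂.sub hv₁)
  -- integrability
  obtain ⟨-, -, hI₁⟩ := integrable_gradSq_sub h hχ hK₁ hχK hv₁ hv₁c
  obtain ⟨-, -, hI₂⟩ := integrable_gradSq_sub h hχ hK₁ hχK hv₂ hv₂c
  obtain ⟨-, -, hIm⟩ := integrable_gradSq_sub h hχ hK₁ hχK hmid hmidc
  obtain ⟨-, -, hI₀⟩ := integrable_gradSq_sub h (contMDiff_const (c := (0 : ℝ))) isCompact_empty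
    (fun x _ ↦ mvfderiv_const (I := I) (0 : ℝ)) (hv₂.sub hv₁) (hv₂c.sub hv₁c)
  have hI₀' : Integrable (fun x ↦ g.gradSq (v₁ - v₂) x) (riemannianMeasure h) := by
    have heq : g.gradSq (v₁ - v₂) = g.gradSq ((fun _ ↦ (0 : ℝ)) - (v₂ - v₁)) := by
      congr 1; funext y; simp
    rw [show (fun x ↦ g.gradSq (v₁ - v₂) x) = g.gradSq (v₁ - v₂) from rfl, heq]; exact hI₀
  -- the pointwise identity
  have hpt : ∀ x, g.gradSq (χ - v₁) x + g.gradSq (χ - v₂) x =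
      2 * g.gradSq (χ - fun y ↦ (1 / 2 : ℝ) * (v₁ y + v₂ y)) x + (1 / 2) * g.gradSq (v₁ - v₂) x := by
    intro x
    have hf : MDiffAt (χ - fun y ↦ (1 / 2 : ℝ) * (v₁ y + v₂ y)) x :=
      ((hχ.sub hmid) x).mdifferentiableAt (by simp)
    have hg' : MDiffAt (fun y ↦ (1 / 2 : ℝ) * (v₂ y - v₁ y)) x := (hdif x).mdifferentiableAt (by simp)
    have hpar := gradSq_add_add_gradSq_sub g hf hg'
    have e1 : (χ - fun y ↦ (1 / 2 : ℝ) * (v₁ y + v₂ y)) + (fun y ↦ (1 / 2 : ℝ) * (v₂ y - v₁ y)) =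
        χ - v₁ := by funext y; simp; ring
    have e2 : (χ - fun y ↦ (1 / 2 : ℝ) * (v₁ y + v₂ y)) - (fun y ↦ (1 / 2 : ℝ) * (v₂ y - v₁ y)) =
        χ - v₂ := by funext y; simp; ring
    have e3 : g.gradSq (fun y ↦ (1 / 2 : ℝ) * (v₂ y - v₁ y)) x = (1 / 2) ^ 2 * g.gradSq (v₂ - v₁) x :=
      gradSq_const_mul g (((hv₂.sub hv₁) x).mdifferentiableAt (by simp)) (1 / 2)
    have e4 : g.gradSq (v₂ - v₁) x = g.gradSq (v₁ - v₂) x := by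
      have hd₁ : MDiffAt v₁ x := (hv₁ x).mdifferentiableAt (by simp)
      have hd₂ : MDiffAt v₂ x := (hv₂ x).mdifferentiableAt (by simp)
      simp only [PseudoRiemannianMetric.gradSq, PseudoRiemannianMetric.innerDual,
        mvfderiv_sub hd₂ hd₁, mvfderiv_sub hd₁ hd₂, ContinuousLinearMap.toLinearMap_sub, map_sub,
        LinearMap.sub_apply]
      ring
    rw [e1, e2, e3, e4] at hpar
    linarith
  -- integrate
  have hint : ∫ x, (g.gradSq (χ - v₁) x + g.gradSq (χ - v₂) x) ∂riemannianMeasure h =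
      ∫ x, (2 * g.gradSq (χ - fun y ↦ (1 / 2 : ℝ) * (v₁ y + v₂ y)) x + (1 / 2) * g.gradSq (v₁ - v₂) x)
        ∂riemannianMeasure h := integral_congr_ae (Eventually.of_forall hpt)
  rw [integral_add hI₁ hI₂, integral_add (hIm.const_mul 2) (hI₀'.const_mul _), integral_const_mul,
    integral_const_mul] at hint
  linarith

/-- **Expansion of the energy along a variation**: for `χ` smooth with compactly supported
differential, `v, ζ ∈ C_c^∞` and `t ∈ ℝ`,
`∫ |d(χ - (v + tζ))|² = ∫ |d(χ - v)|² - 2t ∫ h⁻¹(d(χ - v), dζ) + t² ∫ |dζ|²`.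
[cite: Carron2007, Remark 2.6] -/
theorem integral_gradSq_sub_add_smul {χ v ζ : X → ℝ} (hχ : ContMDiff I 𝓘(ℝ, ℝ) ∞ χ)
    {K₁ : Set X} (hK₁ : IsCompact K₁) (hχK : ∀ x ∉ K₁, mvfderiv I χ x = 0)
    (hv : ContMDiff I 𝓘(ℝ, ℝ) ∞ v) (hvc : HasCompactSupport v)
    (hζ : ContMDiff I 𝓘(ℝ, ℝ) ∞ ζ) (hζc : HasCompactSupport ζ) (t : ℝ) :
    ∫ x, (PseudoRiemannianMetric.ofRiemannian h).gradSq (χ - (v + fun y ↦ t * ζ y)) x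
        ∂riemannianMeasure h =
      ∫ x, (PseudoRiemannianMetric.ofRiemannian h).gradSq (χ - v) x ∂riemannianMeasure h -
      2 * t * ∫ x, (PseudoRiemannianMetric.ofRiemannian h).innerDual x
        (mvfderiv I (χ - v) x).toLinearMap (mvfderiv I ζ x).toLinearMap ∂riemannianMeasure h +
      t ^ 2 * ∫ x, (PseudoRiemannianMetric.ofRiemannian h).gradSq ζ x ∂riemannianMeasure h := by
  haveI : IsFiniteMeasureOnCompacts (riemannianMeasure h) :=
    ⟨fun K hK ↦ riemannianVolume_lt_top_of_isCompact_holds h le_rfl hK⟩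
  set g := PseudoRiemannianMetric.ofRiemannian h with hgdef
  have htζ : ContMDiff I 𝓘(ℝ, ℝ) ∞ (fun y ↦ t * ζ y) := contMDiff_const.mul hζ
  have htζc : HasCompactSupport (fun y ↦ t * ζ y) := hζc.mul_left
  obtain ⟨-, -, hIv⟩ := integrable_gradSq_sub h hχ hK₁ hχK hv hvc
  obtain ⟨hcζ, hsζ, hIζ⟩ := integrable_gradSq_sub h (contMDiff_const (c := (0 : ℝ))) isCompact_empty
    (fun x _ ↦ mvfderiv_const (I := I) (0 : ℝ)) hζ hζc
  have hζeq : g.gradSq ((fun _ ↦ (0 : ℝ)) - ζ) = g.gradSq ζ := by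
    funext x
    have := gradSq_const_mul g (x := x) ((hζ x).mdifferentiableAt (by simp)) (-1)
    have e : (fun y ↦ (-1 : ℝ) * ζ y) = (fun _ ↦ (0 : ℝ)) - ζ := by funext y; simp
    rw [e] at this; rw [this]; ring
  rw [hζeq] at hcζ hsζ hIζ
  -- the cross term is continuous with compact support
  have hw1 : ContMDiff I 𝓘(ℝ, ℝ) 1 (χ - v) := (hχ.sub hv).of_le (by norm_num)
  have hζ1 : ContMDiff I 𝓘(ℝ, ℝ) 1 ζ := hζ.of_le (by norm_num)
  have hcross_c : Continuous fun x ↦ g.innerDual x (mvfderiv I (χ - v) x).toLinearMap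
      (mvfderiv I ζ x).toLinearMap := continuous_innerDual_mvfderiv _ hw1 hζ1
  have hcross_s : HasCompactSupport fun x ↦ g.innerDual x (mvfderiv I (χ - v) x).toLinearMap
      (mvfderiv I ζ x).toLinearMap := by
    refine HasCompactSupport.of_support_subset_isCompact hζc.isCompact fun x hx ↦ ?_
    by_contra hx'
    apply hx
    simp [PseudoRiemannianMetric.innerDual, mvfderiv_eq_zero_of_notMem_tsupport hx']
  have hIcross : Integrable (fun x ↦ g.innerDual x (mvfderiv I (χ - v) x).toLinearMap
      (mvfderiv I ζ x).toLinearMap) (riemannianMeasure h) :=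
    hcross_c.integrable_of_hasCompactSupport hcross_s
  -- pointwise expansion
  have hpt : ∀ x, g.gradSq (χ - (v + fun y ↦ t * ζ y)) x =
      g.gradSq (χ - v) x - 2 * t * g.innerDual x (mvfderiv I (χ - v) x).toLinearMap
        (mvfderiv I ζ x).toLinearMap + t ^ 2 * g.gradSq ζ x := by
    intro x
    have hd1 : MDiffAt (χ - v) x := (hw1 x).mdifferentiableAt one_ne_zero
    have hd2 : MDiffAt (fun y ↦ t * ζ y) x := (htζ x).mdifferentiableAt (by simp)
    have hd3 : MDiffAt ζ x := (hζ1 x).mdifferentiableAt one_ne_zero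
    have e1 : χ - (v + fun y ↦ t * ζ y) = (χ - v) - fun y ↦ t * ζ y := by funext y; simp; ring
    have e2 : mvfderiv I (fun y ↦ t * ζ y) x = t • mvfderiv I ζ x := by
      rw [mvfderiv_fun_mul mdifferentiableAt_const hd3, mvfderiv_const]; simp
    rw [e1]
    simp only [PseudoRiemannianMetric.gradSq, mvfderiv_sub hd1 hd2, e2,
      PseudoRiemannianMetric.innerDual, ContinuousLinearMap.toLinearMap_sub,
      ContinuousLinearMap.toLinearMap_smul, map_sub, map_smul, LinearMap.sub_apply,
      LinearMap.smul_apply, smul_eq_mul]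
    have hs : (mvfderiv I ζ x : TangentSpace I x →ₗ[ℝ] ℝ) (g.sharp x (mvfderiv I (χ - v) x : TangentSpace I x →ₗ[ℝ] ℝ)) =
        (mvfderiv I (χ - v) x : TangentSpace I x →ₗ[ℝ] ℝ) (g.sharp x (mvfderiv I ζ x : TangentSpace I x →ₗ[ℝ] ℝ)) :=
      g.innerDual_comm x _ _
    simp only [ContinuousLinearMap.coe_coe] at hs ⊢
    rw [hs]; ring
  rw [integral_congr_ae (Eventually.of_forall hpt)]
  have hI1 : Integrable (fun x ↦ g.gradSq (χ - v) x) (riemannianMeasure h) := hIv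
  have hI2 : Integrable (fun x ↦ 2 * t * g.innerDual x (mvfderiv I (χ - v) x).toLinearMap
      (mvfderiv I ζ x).toLinearMap) (riemannianMeasure h) := hIcross.const_mul (2 * t)
  have hI3 : Integrable (fun x ↦ t ^ 2 * g.gradSq ζ x) (riemannianMeasure h) := hIζ.const_mul (t ^ 2)
  have hI12 : Integrable (fun x ↦ g.gradSq (χ - v) x - 2 * t * g.innerDual x
      (mvfderiv I (χ - v) x).toLinearMap (mvfderiv I ζ x).toLinearMap) (riemannianMeasure h) :=
    hI1.sub hI2
  have e1 : ∫ x, (g.gradSq (χ - v) x - 2 * t * g.innerDual x (mvfderiv I (χ - v) x).toLinearMap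
      (mvfderiv I ζ x).toLinearMap + t ^ 2 * g.gradSq ζ x) ∂riemannianMeasure h =
      (∫ x, (g.gradSq (χ - v) x - 2 * t * g.innerDual x (mvfderiv I (χ - v) x).toLinearMap
        (mvfderiv I ζ x).toLinearMap) ∂riemannianMeasure h) +
      ∫ x, t ^ 2 * g.gradSq ζ x ∂riemannianMeasure h := integral_add hI12 hI3
  have e2 : ∫ x, (g.gradSq (χ - v) x - 2 * t * g.innerDual x (mvfderiv I (χ - v) x).toLinearMap
      (mvfderiv I ζ x).toLinearMap) ∂riemannianMeasure h =
      (∫ x, g.gradSq (χ - v) x ∂riemannianMeasure h) -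
      ∫ x, 2 * t * g.innerDual x (mvfderiv I (χ - v) x).toLinearMap (mvfderiv I ζ x).toLinearMap
        ∂riemannianMeasure h := integral_sub hI1 hI2
  rw [e1, e2, integral_const_mul, integral_const_mul]

/-- **First variation at an almost-minimiser** (elementary): if `m ≤ a - 2tb + t²c` for all real
`t`, with `c ≥ 0`, then `b² ≤ (a - m) c`. [folklore] -/
theorem sq_le_mul_of_forall_le {a b c m : ℝ} (hc : 0 ≤ c) (hmin : ∀ t : ℝ, m ≤ a - 2 * t * b + t ^ 2 * c) :
    b ^ 2 ≤ (a - m) * c := by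
  rcases eq_or_lt_of_le hc with hc0 | hcpos
  · -- `c = 0`: then `b = 0`
    rw [← hc0, mul_zero]
    have hb : b = 0 := by
      by_contra hb
      have h1 := hmin ((a - m + 1) / (2 * b))
      rw [← hc0, mul_zero, add_zero] at h1
      have : 2 * ((a - m + 1) / (2 * b)) * b = a - m + 1 := by field_simp
      linarith
    rw [hb]; simp
  · have h1 := hmin (b / c)
    have e1 : a - 2 * (b / c) * b + (b / c) ^ 2 * c = a - b ^ 2 / c := by field_simp; ring
    rw [e1] at h1
    have h2 : m * c ≤ (a - b ^ 2 / c) * c := mul_le_mul_of_nonneg_right h1 hc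
    have e2 : (a - b ^ 2 / c) * c = a * c - b ^ 2 := by field_simp
    rw [e2] at h2
    nlinarith

/-- **First variation inequality for the Dirichlet energy** (Carron 2007, Remark 2.6, the Euler–
Lagrange information at a near-minimiser): if `m ≤ ∫ |d(χ - w)|²` for all `w ∈ C_c^∞(X)` and
`v, ζ ∈ C_c^∞`, then `(∫ h⁻¹(d(χ - v), dζ))² ≤ (∫ |d(χ - v)|² - m) ∫ |dζ|²`.
[cite: Carron2007, Remark 2.6] -/
theorem sq_integral_innerDual_le_of_forall_le {χ v ζ : X → ℝ} (hχ : ContMDiff I 𝓘(ℝ, ℝ) ∞ χ)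
    {K₁ : Set X} (hK₁ : IsCompact K₁) (hχK : ∀ x ∉ K₁, mvfderiv I χ x = 0)
    (hv : ContMDiff I 𝓘(ℝ, ℝ) ∞ v) (hvc : HasCompactSupport v)
    (hζ : ContMDiff I 𝓘(ℝ, ℝ) ∞ ζ) (hζc : HasCompactSupport ζ) {m : ℝ}
    (hmin : ∀ w : X → ℝ, ContMDiff I 𝓘(ℝ, ℝ) ∞ w → HasCompactSupport w →
      m ≤ ∫ x, (PseudoRiemannianMetric.ofRiemannian h).gradSq (χ - w) x ∂riemannianMeasure h) :
    (∫ x, (PseudoRiemannianMetric.ofRiemannian h).innerDual x (mvfderiv I (χ - v) x).toLinearMap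
        (mvfderiv I ζ x).toLinearMap ∂riemannianMeasure h) ^ 2 ≤
      ((∫ x, (PseudoRiemannianMetric.ofRiemannian h).gradSq (χ - v) x ∂riemannianMeasure h) - m) *
        ∫ x, (PseudoRiemannianMetric.ofRiemannian h).gradSq ζ x ∂riemannianMeasure h := by
  refine sq_le_mul_of_forall_le (integral_nonneg fun x ↦ innerDual_self_nonneg (h := h) x _)
    fun t ↦ ?_
  rw [← integral_gradSq_sub_add_smul h hχ hK₁ hχK hv hvc hζ hζc t]
  exact hmin _ (hv.add (contMDiff_const.mul hζ)) (hvc.add hζc.mul_left)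

/-! ### The Sobolev inequality in `L^q` form -/

omit [I.Boundaryless] in
/-- **`(S_p)` controls the `L^{2p/(p-2)}` norm of test functions**: under
`HasSobolevInequality h p μ` with `p > 2`, for every `w ∈ C_c^∞(X)`,
`μ · ‖w‖²_{L^q(dV_h)} ≤ ∫ |dw|²_h dV_h` with `q = 2p/(p - 2)` (Carron 2007, proof of Prop. 2.11:
"we find `f ∈ L^{2ν/(ν-2)}`"; the Sobolev inequality rewritten with `eLpNorm`).
[cite: Carron2007, Prop. 2.11 (proof)] -/
theorem ofReal_mul_eLpNorm_sq_le_lintegral_gradSq {p μ : ℝ} (hp : 2 < p)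
    (hS : HasSobolevInequality h p μ) {w : X → ℝ} (hw : ContMDiff I 𝓘(ℝ, ℝ) ∞ w)
    (hwc : HasCompactSupport w) :
    ENNReal.ofReal μ * eLpNorm w (ENNReal.ofReal (2 * p / (p - 2))) (riemannianMeasure h) ^ (2 : ℝ) ≤
      ∫⁻ x, ENNReal.ofReal ((PseudoRiemannianMetric.ofRiemannian h).gradSq w x)
        ∂riemannianMeasure h := by
  have hSw := hS w hw hwc
  set q : ℝ := 2 * p / (p - 2) with hq
  have hp2 : 0 < p - 2 := by linarith
  have hqpos : 0 < q := by rw [hq]; positivity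
  have hq0 : ENNReal.ofReal q ≠ 0 := (ENNReal.ofReal_pos.2 hqpos).ne'
  have hθ : 1 - 2 / p = 1 / q * 2 := by
    rw [hq]; field_simp
  -- rewrite the `L^q` integral of the Sobolev inequality as `eLpNorm ^ 2`
  have hint : ∫⁻ x, ENNReal.ofReal (|w x| ^ q) ∂riemannianMeasure h =
      ∫⁻ x, ‖w x‖ₑ ^ q ∂riemannianMeasure h := by
    refine lintegral_congr fun x ↦ ?_
    rw [Real.enorm_eq_ofReal_abs, ENNReal.ofReal_rpow_of_nonneg (abs_nonneg _) hqpos.le]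
  have heq : (∫⁻ x, ENNReal.ofReal (|w x| ^ q) ∂riemannianMeasure h) ^ (1 - 2 / p) =
      eLpNorm w (ENNReal.ofReal q) (riemannianMeasure h) ^ (2 : ℝ) := by
    rw [eLpNorm_eq_lintegral_rpow_enorm_toReal hq0 ENNReal.ofReal_ne_top,
      ENNReal.toReal_ofReal hqpos.le, ← ENNReal.rpow_mul, hθ, hint]
  rw [← heq]
  exact hSw

end Energy

end Literature.Geometry.Riemannian

end
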